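import Mathlib
import Literature.MathematicalPhysics.QuantumFieldTheory.Balaban1983to89.Beta.VolumeConvolution
import Literature.MathematicalPhysics.QuantumFieldTheory.Balaban1983to89.B5Torus145Decay

/-!
# `Balaban1983to89.Beta.VolumePeriodise` — the joiner: torus kernels of strip-regular Fourier multipliers (pv17's
# periodisation engine `B4TorusKernel`) ARE image sums of (5.10)-decaying `ℤ^{d+1}` kernels, hence carry explicit volume rates;
# instance: the finite-torus kernel of `(Q′G′²Q′*)⁻¹` (B5 (1.45), `B5Torus145Decay`)

T. Bałaban, *Renormalization group approach to lattice gauge field theories. I.*, Commun. Math. Phys. **109**, 249–301 (1987)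
[Balaban1987RG1] (cell paper B12; PDF page = journal page − 248); T. Bałaban, *Propagators and renormalization transformations
for lattice gauge theories. I*, Commun. Math. Phys. **95**, 17–40 (1984) [Balaban1984PropagatorsI] (cell paper B5; PDF page =
journal page − 16).

HONEST FRAMING (cell rule, verbatim): discharging `BetaPertH` makes Bałaban's UV stability UNCONDITIONAL — a real
constructive-QFT result; it is NOT the continuum limit and NOT the Clay problem.  THIS MODULE ASSERTS NOTHING about the series
and nothing about β.  It joins two kernel-checked frameworks already in the tree, IMPORTED AND USED BY NAME and modified in no
way: the momentum-side periodisation engine `B4ContourShift` / `B4TorusKernel` / `B5Torus145Decay` (b2b-balaban-pv17, b04 lineage: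
`StripRegular`, `latticeKernel`, `latticeKernel_decay`, `translate`, `torusKernel`, `descendC`, `torusKernel_descend_eq`,
`torusKernel145`, `torusKernel145_eq_periodise`, `exists_stripRegular_inverse145`) and the window/ℓ¹ image-sum calculus
`Beta/VolumeImages` / `Beta/VolumeAffine` / `Beta/VolumeConvolution` (this lineage: `imageShift`, `IsImageSum`, `Decay510`-rates,
`IsImageSum.scalarVolumeRate`).  Value = a kernel joiner behind a located gap (GAPS G-beta-4 / G-pv04-7 (i)), NOT summit progress.

WHAT THE PAPERS PRINT (CONTEXT ONLY; renders re-read by this unit: `…1984-cmp95-propagators-rt-I-p020-x2.png`,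
`…1987-cmp109-rg-I-small-field-p016-x2.png`).  B5 p. 36: "Probably the simplest proof of the exponential decay properties can be
obtained by relating G on the torus to G on the whole lattice ηZ^d in the usual way, and then proving that the operator
e^{−⟨q,x⟩}Δ_a e^{⟨q,x⟩} − Δ_a is a small perturbation of Δ_a for vectors q∈R^d sufficiently small. Instead we construct a random
walk representation of the kind described in [2]."  B12 p. 264, after (1.21): "Now we take a limit of these functions as
T^{(j+1)} ↗ Z^d. This limit exists by the localized representation (1.7)."  Neither paper prints the periodisation identity, a
decay constant, or a volume rate; "the usual way" is what pv17's engine and this joiner make explicit.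

CONTENTS (all [folklore], hypothesis-typed):
* §1 NORMS.  `l1_le_mul_supNorm : |y|₁ ≤ (d+1)·|y|_∞`; sup-norm exponential decay `‖K y‖ ≤ M e^{−κ|y|_∞}` (the output format of
  `B4ContourShift.latticeKernel_decay`) implies `Decay510 (‖K ·‖) M (κ/(d+1))` (the input format (5.10) of the image-sum calculus),
  and `Decay510` passes to real and imaginary parts.
* §2 IMAGE SUMS FROM PERIODISATION IDENTITIES.  `translate_eq_imageShift` (pv17's `translate N x m` IS `imageShift N x m`, `rfl`);
  a periodisation identity `f t x = Σ'_m K (windowMap x + side t·m)` with `Decay510 (‖K ·‖) M δ`, `δ > 0`, gives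
  `IsImageSum side (re ∘ f) (re ∘ K)` and `(im ∘ f) (im ∘ K)` (absolute convergence + `Complex.reCLM/imCLM`).
* §3 GENERIC STRIP-REGULAR MULTIPLIERS (`d+1` dimensions).  For `StripRegular G κ M` with `κ > 0` and ANY family of torus sides
  `side t ≥ 1`: the real and imaginary parts of pv17's torus kernels `B4TorusKernel.torusKernel (descendC G …) (side t) (windowMap x)` form
  `IsImageSum` families of `latticeKernel G`, which is `Decay510` with constant `M` and rate `κ/(d+1)`
  (`isImageSum_torusKernel_descend`); COROLLARY `scalarVolumeRate_torusKernel_descend_re/_im`: the EXPLICIT torus-versus-lattice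
  VOLUME RATE `|Re K_N(windowMap x) − Re K(windowMap x)| ≤ M·imageTail (d+1) ((κ/(d+1))·N/4)·e^{−(κ/(2(d+1)))|windowMap x|₁}` — new
  relative to `B4TorusKernel.torusKernel_descend_decay` (which is decay uniform in `N`, not a rate of convergence in `N`).
* §4 THE (1.45) INSTANCE.  For `a > 0` there are `κ, c > 0` (those of `exists_stripRegular_inverse145`, uniform in `n = L^k`) with:
  for every `n ≥ 1`, the real/imaginary parts of `torusKernel145 n a (side t) (windowMap x)` are `IsImageSum` families of the
  `ℤ^{d+1}` kernel `latticeKernel (1/mReg_{n,a})`, which is `Decay510` with constant `c⁻¹`, rate `κ/(d+1)`; and the explicit volume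
  rate follows (`isImageSum_torusKernel145`, `scalarVolumeRate_torusKernel145_re`).  This is the first CERTIFIED Bałaban constituent
  inside the image-sum class: (Q2′) of GAPS G-pv04-7 (i) is discharged FOR THIS KERNEL (with `κ, c` existential but `n`- and
  volume-uniform, exactly as in pv17's `inverse145_torusKernel_decay`); for the other constituents of `Π⁰_{k+1}` it is unchanged.

ABSOLUTE RULE.  No internally-minted statement enters as a cited fact: there are no cited facts in this file; every hypothesis is
a kernel-proved theorem of the imported modules or a binder.  Companion prose: `run/shared/lean/pub/pub-balaban/b2b-balaban-pv04/
VOLUME-IMAGES.md` §7; GAPS rows C-pv04-16 / G-pv04-7.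
-/

namespace Literature.MathematicalPhysics.QuantumFieldTheory.Balaban1983to89.Beta

open Literature.MathematicalPhysics.QuantumFieldTheory.Balaban1983to89
open Literature.MathematicalPhysics.QuantumFieldTheory.Balaban1983to89.B12Sec2to5 (l1 l1_nonneg Decay510 summable_exp_neg_l1)
open Literature.MathematicalPhysics.QuantumFieldTheory.Balaban1983to89.B4ContourShift (supNorm supNorm_nonneg abs_le_supNorm
  latticeKernel StripRegular latticeKernel_decay)
open Literature.MathematicalPhysics.QuantumFieldTheory.Balaban1983to89.B4TorusKernel (translate translate_apply
  sum_abs_le_mul_supNorm descendC torusKernel_descend_eq)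
open Literature.MathematicalPhysics.QuantumFieldTheory.Balaban1983to89.B5Strip145 (mReg)
open Literature.MathematicalPhysics.QuantumFieldTheory.Balaban1983to89.B5Torus145Decay (torusKernel145
  torusKernel145_eq_torusKernel torusKernel145_eq_periodise exists_stripRegular_inverse145)

/-! ## §1. Norm comparison and decay formats -/

section Norms

variable {d : ℕ}

/-- `|y|₁` as a sum of cast absolute values. [folklore] -/
theorem l1_eq_sum_cast_abs (y : Fin d → ℤ) : l1 y = ∑ i, ((|y i| : ℤ) : ℝ) := by
  simp [l1, Int.cast_abs]

/-- `|y|₁ ≤ (d+1)·|y|_∞` on `ℤ^{d+1}`. [folklore] -/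
theorem l1_le_mul_supNorm (y : Fin (d + 1) → ℤ) : l1 y ≤ (d + 1) * supNorm y := by
  rw [l1_eq_sum_cast_abs]; exact sum_abs_le_mul_supNorm y

/-- SUP-NORM DECAY ⇒ (5.10)-DECAY IN `|·|₁`: `‖K y‖ ≤ M e^{−κ|y|_∞}` (`κ ≥ 0`) gives `Decay510 (‖K ·‖) M (κ/(d+1))`. [folklore] -/
theorem decay510_norm_of_supNorm {K : (Fin (d + 1) → ℤ) → ℂ} {M κ : ℝ}
    (hK : ∀ y, ‖K y‖ ≤ M * Real.exp (-(κ * supNorm y))) (hκ : 0 ≤ κ) :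
    Decay510 (fun y => ‖K y‖) M (κ / (d + 1)) := by
  intro y
  have hM : 0 ≤ M :=
    le_of_mul_le_mul_right (by rw [zero_mul]; exact (norm_nonneg (K y)).trans (hK y)) (Real.exp_pos (-(κ * supNorm y)))
  show |‖K y‖| ≤ M * Real.exp (-(κ / (d + 1)) * l1 y)
  rw [abs_norm]
  refine (hK y).trans (mul_le_mul_of_nonneg_left ?_ hM)
  rw [Real.exp_le_exp]
  have hd : (0 : ℝ) < d + 1 := by positivity
  have h1 : κ / (d + 1) * l1 y ≤ κ / (d + 1) * ((d + 1) * supNorm y) :=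
    mul_le_mul_of_nonneg_left (l1_le_mul_supNorm y) (div_nonneg hκ hd.le)
  rw [← mul_assoc, div_mul_cancel₀ κ hd.ne'] at h1
  linarith

/-- (5.10)-decay of the norm passes to the real part. [folklore] -/
theorem decay510_re_of_norm {K : (Fin d → ℤ) → ℂ} {M δ : ℝ} (h : Decay510 (fun y => ‖K y‖) M δ) :
    Decay510 (fun y => (K y).re) M δ := fun y =>
  (Complex.abs_re_le_norm (K y)).trans (by simpa [abs_norm] using h y)

/-- (5.10)-decay of the norm passes to the imaginary part. [folklore] -/
theorem decay510_im_of_norm {K : (Fin d → ℤ) → ℂ} {M δ : ℝ} (h : Decay510 (fun y => ‖K y‖) M δ) :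
    Decay510 (fun y => (K y).im) M δ := fun y =>
  (Complex.abs_im_le_norm (K y)).trans (by simpa [abs_norm] using h y)

end Norms

/-! ## §2. Image sums from periodisation identities -/

section Periodise

variable {d : ℕ}

/-- pv17's `translate N x m = x + N·m` IS `imageShift N x m` (definitionally). [folklore] -/
theorem translate_eq_imageShift (N : ℕ) (x m : Fin (d + 1) → ℤ) : translate N x m = imageShift N x m := rfl

variable {s : ℕ} [NeZero s]

/-- Summability of a complex kernel over the images of an in-window base point, from (5.10)-decay of its norm with rate `δ > 0`.
[folklore] -/
theorem summable_imageShift_of_norm {K : (Fin d → ℤ) → ℂ} {M δ : ℝ} (hK : Decay510 (fun y => ‖K y‖) M δ) (hδ : 0 < δ)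
    {w : Fin d → ℤ} (hw : ∀ i, InWindow s (w i)) : Summable (fun n : Fin d → ℤ => K (imageShift s w n)) :=
  Summable.of_norm (by simpa [abs_norm] using summable_abs_imageShift hK hδ hw)

variable {side : ℕ → ℕ} [∀ t, NeZero (side t)]

/-- **IMAGE SUM FROM A PERIODISATION IDENTITY (real part).**  If `f t x = Σ'_m K (windowMap x + side t·m)` on every torus and
`‖K‖` is (5.10)-decaying with rate `δ > 0`, then `re ∘ f` is the image sum of `re ∘ K`. [folklore] -/
theorem isImageSum_re_of_tsum_eq {K : (Fin d → ℤ) → ℂ} {M δ : ℝ} (hK : Decay510 (fun y => ‖K y‖) M δ) (hδ : 0 < δ)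
    {f : (t : ℕ) → Site d (side t) → ℂ}
    (hf : ∀ t x, f t x = ∑' m : Fin d → ℤ, K (imageShift (side t) (windowMap d (side t) x) m)) :
    IsImageSum side (fun t x => (f t x).re) (fun y => (K y).re) := by
  intro t x
  show HasSum (fun n : Fin d → ℤ => (K (imageShift (side t) (windowMap d (side t) x) n)).re) ((f t x).re)
  rw [hf t x]
  simpa using Complex.reCLM.hasSum (summable_imageShift_of_norm hK hδ (inWindow_windowMap x)).hasSum

/-- **IMAGE SUM FROM A PERIODISATION IDENTITY (imaginary part).** [folklore] -/
theorem isImageSum_im_of_tsum_eq {K : (Fin d → ℤ) → ℂ} {M δ : ℝ} (hK : Decay510 (fun y => ‖K y‖) M δ) (hδ : 0 < δ)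
    {f : (t : ℕ) → Site d (side t) → ℂ}
    (hf : ∀ t x, f t x = ∑' m : Fin d → ℤ, K (imageShift (side t) (windowMap d (side t) x) m)) :
    IsImageSum side (fun t x => (f t x).im) (fun y => (K y).im) := by
  intro t x
  show HasSum (fun n : Fin d → ℤ => (K (imageShift (side t) (windowMap d (side t) x) n)).im) ((f t x).im)
  rw [hf t x]
  simpa using Complex.imCLM.hasSum (summable_imageShift_of_norm hK hδ (inWindow_windowMap x)).hasSum

end Periodise

/-! ## §3. Generic strip-regular multipliers: pv17's torus kernels are image sums with explicit volume rates -/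

section StripRegularMultipliers

variable {d : ℕ} {side : ℕ → ℕ} [∀ t, NeZero (side t)]

/-- every side of the family is `≥ 1`. [folklore] -/
theorem one_le_side (side : ℕ → ℕ) [∀ t, NeZero (side t)] (t : ℕ) : 1 ≤ side t :=
  Nat.one_le_iff_ne_zero.mpr (NeZero.ne (side t))

/-- **TORUS KERNELS OF STRIP-REGULAR MULTIPLIERS ARE IMAGE SUMS.**  For `StripRegular G κ M` with `κ > 0`: the real and imaginary
parts of the torus kernels `B4TorusKernel.torusKernel (descendC G …) (side t)` evaluated at window representatives form `IsImageSum` families of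
the `ℤ^{d+1}` kernel `latticeKernel G`, whose real and imaginary parts are `Decay510` with constant `M` and rate `κ/(d+1)`.
(Assembled from `B4TorusKernel.torusKernel_descend_eq` and `B4ContourShift.latticeKernel_decay`.) [folklore] -/
theorem isImageSum_torusKernel_descend {G : (Fin (d + 1) → ℂ) → ℂ} {κ M : ℝ} (h : StripRegular G κ M) (hκ : 0 < κ)
    (side : ℕ → ℕ) [∀ t, NeZero (side t)] :
    IsImageSum side (fun t x => (B4TorusKernel.torusKernel (descendC G h hκ.le) (side t) (windowMap (d + 1) (side t) x)).re)
        (fun y => (latticeKernel G y).re) ∧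
      IsImageSum side (fun t x => (B4TorusKernel.torusKernel (descendC G h hκ.le) (side t) (windowMap (d + 1) (side t) x)).im)
        (fun y => (latticeKernel G y).im) ∧
      Decay510 (fun y => (latticeKernel G y).re) M (κ / (d + 1)) ∧
      Decay510 (fun y => (latticeKernel G y).im) M (κ / (d + 1)) := by
  have hnorm : Decay510 (fun y => ‖latticeKernel G y‖) M (κ / (d + 1)) :=
    decay510_norm_of_supNorm (latticeKernel_decay h hκ.le) hκ.le
  have hrate : 0 < κ / (d + 1) := div_pos hκ (by positivity)
  have hf : ∀ (t : ℕ) (x : Site (d + 1) (side t)),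
      B4TorusKernel.torusKernel (descendC G h hκ.le) (side t) (windowMap (d + 1) (side t) x) =
        ∑' m : Fin (d + 1) → ℤ, latticeKernel G (imageShift (side t) (windowMap (d + 1) (side t) x) m) :=
    fun t x => torusKernel_descend_eq h hκ (one_le_side side t) (windowMap (d + 1) (side t) x)
  exact ⟨isImageSum_re_of_tsum_eq hnorm hrate hf, isImageSum_im_of_tsum_eq hnorm hrate hf,
    decay510_re_of_norm hnorm, decay510_im_of_norm hnorm⟩

/-- **EXPLICIT TORUS-VERSUS-LATTICE VOLUME RATE for the real part of the torus kernel of a strip-regular multiplier**: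
`|Re K_N(windowMap x) − Re K(windowMap x)| ≤ M·imageTail (d+1) ((κ/(d+1))·N/4)·e^{−((κ/(d+1))/2)|windowMap x|₁}` along any family of
sides (`VolumeImages.IsImageSum.scalarVolumeRate`). [folklore] -/
theorem scalarVolumeRate_torusKernel_descend_re {G : (Fin (d + 1) → ℂ) → ℂ} {κ M : ℝ} (h : StripRegular G κ M)
    (hκ : 0 < κ) (side : ℕ → ℕ) [∀ t, NeZero (side t)] :
    ScalarVolumeRate side (fun t x => (B4TorusKernel.torusKernel (descendC G h hκ.le) (side t) (windowMap (d + 1) (side t) x)).re)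
      (fun y => (latticeKernel G y).re) (fun t => M * imageTail (d + 1) (κ / (d + 1) * side t / 4)) (κ / (d + 1) / 2) :=
  (isImageSum_torusKernel_descend h hκ side).1.scalarVolumeRate (isImageSum_torusKernel_descend h hκ side).2.2.1
    (div_pos hκ (by positivity))

/-- The same volume rate for the imaginary part. [folklore] -/
theorem scalarVolumeRate_torusKernel_descend_im {G : (Fin (d + 1) → ℂ) → ℂ} {κ M : ℝ} (h : StripRegular G κ M)
    (hκ : 0 < κ) (side : ℕ → ℕ) [∀ t, NeZero (side t)] :
    ScalarVolumeRate side (fun t x => (B4TorusKernel.torusKernel (descendC G h hκ.le) (side t) (windowMap (d + 1) (side t) x)).im)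
      (fun y => (latticeKernel G y).im) (fun t => M * imageTail (d + 1) (κ / (d + 1) * side t / 4)) (κ / (d + 1) / 2) :=
  (isImageSum_torusKernel_descend h hκ side).2.1.scalarVolumeRate (isImageSum_torusKernel_descend h hκ side).2.2.2
    (div_pos hκ (by positivity))

end StripRegularMultipliers

/-! ## §4. The instance: the finite-torus kernel of `(Q′G′²Q′*)⁻¹` (B5 (1.45)) -/

section Kernel145

variable {d : ℕ}

/-- **THE (1.45) TORUS KERNEL IS AN IMAGE SUM OF A (5.10)-DECAYING `ℤ^{d+1}` KERNEL, uniformly in `n = L^k`.**  For `a > 0` there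
are `κ, c > 0` (from `B5Torus145Decay.exists_stripRegular_inverse145`) such that for every `n ≥ 1` and every family of torus sides:
the real and imaginary parts of `torusKernel145 n a (side t) (windowMap x)` are the image sums of those of
`latticeKernel (1/mReg_{n,a})`, and the latter are `Decay510` with constant `c⁻¹` and rate `κ/(d+1)`.  (Periodisation identity:
`B5Torus145Decay.torusKernel145_eq_periodise`; decay: `B4ContourShift.latticeKernel_decay`.) [folklore] -/
theorem isImageSum_torusKernel145 (side : ℕ → ℕ) [∀ t, NeZero (side t)] {a : ℝ} (ha : 0 < a) :
    ∃ κ c : ℝ, 0 < κ ∧ 0 < c ∧ ∀ (n : ℕ) [NeZero n],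
      IsImageSum side (fun t x => (torusKernel145 (d := d) n a (side t) (windowMap (d + 1) (side t) x)).re)
          (fun y => (latticeKernel (fun p : Fin (d + 1) → ℂ => (mReg n a p)⁻¹) y).re) ∧
        IsImageSum side (fun t x => (torusKernel145 (d := d) n a (side t) (windowMap (d + 1) (side t) x)).im)
          (fun y => (latticeKernel (fun p : Fin (d + 1) → ℂ => (mReg n a p)⁻¹) y).im) ∧
        Decay510 (fun y => (latticeKernel (fun p : Fin (d + 1) → ℂ => (mReg n a p)⁻¹) y).re) c⁻¹ (κ / (d + 1)) ∧
        Decay510 (fun y => (latticeKernel (fun p : Fin (d + 1) → ℂ => (mReg n a p)⁻¹) y).im) c⁻¹ (κ / (d + 1)) := by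
  obtain ⟨κ, c, hκ, hc, hreg⟩ := exists_stripRegular_inverse145 (d := d) ha
  refine ⟨κ, c, hκ, hc, fun n _ => ?_⟩
  have h4 := isImageSum_torusKernel_descend (hreg n) hκ side
  have e : ∀ (t : ℕ) (x : Site (d + 1) (side t)),
      torusKernel145 (d := d) n a (side t) (windowMap (d + 1) (side t) x) =
        B4TorusKernel.torusKernel (descendC _ (hreg n) hκ.le) (side t) (windowMap (d + 1) (side t) x) :=
    fun t x => torusKernel145_eq_torusKernel n a (hreg n) hκ.le (side t) (windowMap (d + 1) (side t) x)
  refine ⟨fun t x => ?_, fun t x => ?_, h4.2.2.1, h4.2.2.2⟩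
  · have := h4.1 t x
    simp only [← e] at this
    exact this
  · have := h4.2.1 t x
    simp only [← e] at this
    exact this

/-- **EXPLICIT VOLUME RATE FOR THE (1.45) TORUS KERNEL (real part)**, uniformly in `n = L^k`: with the `κ, c` above,
`|Re K^{(1.45)}_{n,N}(windowMap x) − Re K^{(1.45)}_{n,∞}(windowMap x)| ≤ c⁻¹·imageTail (d+1) ((κ/(d+1))·N/4)·e^{−((κ/(d+1))/2)|windowMap x|₁}`.
[folklore] -/
theorem scalarVolumeRate_torusKernel145_re (side : ℕ → ℕ) [∀ t, NeZero (side t)] {a : ℝ} (ha : 0 < a) :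
    ∃ κ c : ℝ, 0 < κ ∧ 0 < c ∧ ∀ (n : ℕ) [NeZero n],
      ScalarVolumeRate side (fun t x => (torusKernel145 (d := d) n a (side t) (windowMap (d + 1) (side t) x)).re)
        (fun y => (latticeKernel (fun p : Fin (d + 1) → ℂ => (mReg n a p)⁻¹) y).re)
        (fun t => c⁻¹ * imageTail (d + 1) (κ / (d + 1) * side t / 4)) (κ / (d + 1) / 2) := by
  obtain ⟨κ, c, hκ, hc, h⟩ := isImageSum_torusKernel145 (d := d) side ha
  refine ⟨κ, c, hκ, hc, fun n _ => ?_⟩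
  have hn := h n
  exact hn.1.scalarVolumeRate hn.2.2.1 (div_pos hκ (by positivity))

end Kernel145

end Literature.MathematicalPhysics.QuantumFieldTheory.Balaban1983to89.Beta
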